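import Summits.BirchSwinnertonDyer.BirchSwinnertonDyer.Theorems.ErratumRoadFiveEulerHalfNotRamInertUpToOneTwo
import Summits.BirchSwinnertonDyer.BirchSwinnertonDyer.Theorems.ErratumRoadFiveEulerHalfNotRamInertUpToOneDatumTwo
import Literature.NumberTheory.EllipticCurves.SemistablePeuRamifieRamifiedPrime
import HarnessLib

/-!
# Route `ErratumRoadFive` (K2, `p ≥ 5`), crux `EulerHalfNotRamNoInertSetAtFive` (item stmt-BirchSwinnertonDyer-19715), line `birth` v10 → v11:
# the up-to-one₂ road WITH THE (W)-WITNESS AT `p` (sharp datum), and the LEVEL-LOWERING CUT — the residual consists of NON-SEMISTABLE SELF-CARRIER pairs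
# (cell `bsd-stepL`, width seat `bsd-line-er5-p1-w2` g1; `--supports stmt-BirchSwinnertonDyer-19715 --as helper`)

WHAT. v10 (this seat's turnkey, evidence #53) reaches S2b by three data roads — inert₂ (p609923), split (p611250), up-to-one₂ (p624790) — and leaves the
residual «three offending split carriers `≡ 1 (mod p)`». Two further honest cuts, both in print currency:
* (W♯) lane B's D-core (and its `2`-relaxed copy `…twinLowerD₂`, p624790 §0) accepts, instead of the Papikian–Rabinoff half, Pasten's Lemma 6.15 WITNESS
  inside `S`: a multiplicative `ℓ₁ ∈ S` with `p ∤ ord_{ℓ₁} Δ_min`. Under the crux's hypothesis ¬(ram) every multiplicative `ℓ ≠ p` has `p ∣ ord_ℓ Δ_min`,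
  so the only possible witness is `p` itself: `p ∤ ord_p Δ_min`. §1 `res_otherMultUpToOne₂SharpAtFive_of_savedDisplayD_of_lowerX11a` = the up-to-one₂ road
  with the datum's (DEG) clause widened to `¬ p ∣ ord_p Δ_min ∨ (half with ¬ p ∣ q − 1)` (bsd-idea-9 g3's «(B♯) free widening», in the `2`-relaxed currency).
  §2 `inertDatum₂_or_upToOneSharpDatum₂_of_not_dvd_ordp`: if `p ∤ ord_p Δ_min` a datum ALWAYS exists (`S = {p} ∪ Off`, or minus one exempted offender for
  parity, or `{p, m}` when there is no offender) — so the residual acquires the necessary condition `p ∣ ord_p Δ_min` («`p` is a self-carrier»).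
* (LL) §3 `not_dvd_ordp_of_semistable_of_not_ram`: on a SEMISTABLE curve, `p ≥ 5` multiplicative with `E[p]` irreducible and NO (ram) prime force
  `p ∤ ord_p Δ_min` — contrapositive of the TREE theorem `ram_of_semistable_of_irr_of_mult_of_dvd` (Ribet's level lowering to level one; printed inputs
  `exists_isNewformOf` = a conjunct of `PublishedInputsFive` and the EXISTING named fact `Literature.NumberTheory.Automorphic.diamond1995_refinedSerre`,
  Ribet 1990 Thm. 1.1 ∕ Diamond 1995 Thm. 1.1). Hence the residual is NON-SEMISTABLE (bsd-idea-9 g3's idea «level-lowering-cut», Ideas/level-lowering-cut.md).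
* §4 `res_otherMultNoSplitDatumAtFive_of_inert₂_of_upToOne₂Sharp_of_nonSemistableSelfCarrier` — v9's S2b shape VERBATIM as conclusion from the inert₂ road
  (∀-form), the up-to-one₂♯ road (∀-form), `exists_isNewformOf`, `diamond1995_refinedSerre`, and the v11 RESIDUAL `hC3₃` := v10's residual
  (`stub_res_otherMultThreeOneModOffendingAtFive`) PLUS `p ∣ ord_p Δ_min` PLUS `¬ Semistable W`, with «no up-to-one₂ datum» read in the ♯ form. Pure logic +
  §2 + §3 + the datum lemma₂ (p625102).
CENSUS: unchanged (0 residual pairs below `5·10⁵`; all 404 pairs of 19715 have `p ∣ ∏c`, and the lead's table has no semistable residual pair). Class-wide the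
v11 residual is: non-semistable `E`, `p ≥ 5` a split∕multiplicative SELF-CARRIER, every other multiplicative prime a `p`-carrier (¬(ram)), ≥ 3 split ones
`≡ 1 (mod p)`, and no inert₂ ∕ split ∕ up-to-one₂♯ datum — the shape on which `StringentKolyvaginCapsAtMax` bites (two Tamagawa savings on one frame).

HONEST FRAMING: THEOREMS ONLY (no definition, no named fact minted — `diamond1995_refinedSerre` EXISTS in `Literature/NumberTheory/Automorphic/SerreWeakImpliesStrong.lean`
and enters as a hypothesis BY NAME; no `sorry`); CONDITIONAL on every displayed binder; nothing booked; no stub or item closes by this file; 19715 OPEN; BSD is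
proved for no curve; no summit statement touched. Credit: bsd-idea-9 g3 (ideas «(B♯) widening» and «level-lowering cut», sketch `Lines/level_lowering_cut.lean`
14ebb030554f — §3 is its §3a verbatim), lane B corner3-p2 (D-core), the Literature seat of `SemistablePeuRamifieRamifiedPrime.lean`.
-- adapted from Summits/BirchSwinnertonDyer/BirchSwinnertonDyer/Cruxes/EulerHalfNotRamNoInertSetAtFive/Lines/level_lowering_cut.lean (§3a)
References (locators only): [cite: PastenShimura2024, §6.6, Lemmas 6.15, 6.18] [cite: PapikianRabinoff2016, Cor. 3.5] [cite: Ribet1990, Thm. 1.1]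
[cite: Diamond1995RefinedSerre, Thm. 1.1] [cite: Serre1987, §4.1 (4.1.12)] [cite: Jetchev2008, Thm. 1.1, Conj. 1.2].
-/

set_option autoImplicit false
set_option linter.dupNamespace false

noncomputable section

open scoped Classical

open WeierstrassCurve Literature.NumberTheory.EllipticCurves Literature.NumberTheory.EllipticCurves.Rank1Residual
  Literature.NumberTheory.EllipticCurves.ModularForms Literature.NumberTheory.Automorphic
  Literature.NumberTheory.EllipticCurves.BarriosEtAl2025
  Literature.NumberTheory.EllipticCurves.Rank1Residual.Typed Summit.BirchSwinnertonDyer.Rank1Residual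
  Summit.BirchSwinnertonDyer.Rank1Residual.X11b

namespace Summit.BirchSwinnertonDyer.BirchSwinnertonDyer.Theorems.EulerHalfInertUpToOne

/-! ### §1 The up-to-one₂ road with the (W)-witness at `p` allowed (sharp datum) -/

/-- **S2b′₂♯ — the up-to-one₂ road with (DEG) = «`p ∤ ord_p Δ_min` OR a Papikian–Rabinoff half of primes `q` with `p ∤ q − 1`»:** for every X11b ∧ `p ≥ 5` ∧
`ρ̄` onto ∧ ¬(ram) pair carrying an offending split carrier `q₁`, an even multiplicative `S ∋ p`, `q₁ ∉ S`, admissible off `q₁`, and EITHER the Lemma-6.15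
witness `p` (`p ∤ ord_p Δ_min`, `p ∈ S`) OR the half: `Typed.MissingUpperBoundAt W p` — p624790's §1∕§2 with the (DEG) datum passed through to the core₂
(`…extraPlace_odd_of_twinLowerD₂`, whose `hdegDatum` already takes the witness). Binders as p624790 (printed inputs, `hBR`, X11a lower half ∀, the v9 SAV
stub's ∀-form `hSavD`). CONDITIONAL; nothing booked. [cite: PastenShimura2024, Lemmas 6.15, 6.18] [cite: Jetchev2008, Cor. 1.5] -/
theorem res_otherMultUpToOne₂SharpAtFive_of_savedDisplayD_of_lowerX11a
    (hGZK : rank_eq_analyticRank_of_analyticRank_le_one) (hmod : hasEntireLFunction_rat)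
    (hnf : exists_isNewformOf) (hFH : friedbergHoffstein_exists_twist_ne_zero_inertAt)
    (hMaz : mazur_not_dvd_maninConstant_of_odd)
    (hBR : localTamagawaNumber_quadraticTwist_two_mem_of_goodReduction)
    (hJL : nonempty_shimuraParametrizationData)
    (hCO : PastenShimura2024_componentOrders)
    (hX11a : ∀ (Wd : WeierstrassCurve ℚ) [Wd.IsElliptic] [Wd.IsGloballyMinimal] (p : ℕ) [Fact p.Prime],
      ClassX11a Wd p → Typed.MissingLowerBoundAt Wd p)
    (hSavD : ∀ (W : WeierstrassCurve ℚ) [W.IsElliptic] [W.IsGloballyMinimal] (p : ℕ) [Fact p.Prime]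
      (q₁ : ℕ) [Fact q₁.Prime], ClassX11b W p → 5 ≤ p → Surj W p → ¬ Ram W p →
      W.HasSplitMultiplicativeReductionAtPrime q₁ → p ∣ padicValInt q₁ W.minimalDiscriminantInt →
      Theorems.ShimuraInertSavedDisplayAtD W p q₁) :
    ∀ (W : WeierstrassCurve ℚ) [W.IsElliptic] [W.IsGloballyMinimal] (p : ℕ) [Fact p.Prime],
      ClassX11b W p → 5 ≤ p → Surj W p → ¬ Ram W p →
      (∃ (q₁ : ℕ) (_ : Fact q₁.Prime) (S : Finset ℕ), W.HasSplitMultiplicativeReductionAtPrime q₁ ∧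
        p ∣ padicValInt q₁ W.minimalDiscriminantInt ∧
        (∀ ℓ ∈ S, ∃ _ : Fact ℓ.Prime, Mult W ℓ) ∧ Even S.card ∧ p ∈ S ∧ q₁ ∉ S ∧
        (∀ (ℓ : ℕ) [Fact ℓ.Prime], ℓ ∉ S → ℓ ≠ q₁ → W.HasSplitMultiplicativeReductionAtPrime ℓ →
          ¬ p ∣ padicValInt ℓ W.minimalDiscriminantInt) ∧
        (¬ p ∣ padicValInt p W.minimalDiscriminantInt ∨
          ∃ R ⊆ S, S.card = 2 * R.card ∧ ∀ q ∈ R, ¬ p ∣ q - 1)) →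
      Typed.MissingUpperBoundAt W p := by
  intro W _ _ p _ hX hp5 hsurj hnram hdat
  obtain ⟨q₁, _, S, hq₁, hoff, hSmult, hSeven, hpS, hq₁S, hFC, hdeg⟩ := hdat
  have hbad₁ : ¬ W.HasGoodReductionAtPrime q₁ :=
    WeierstrassCurve.HasMultiplicativeReduction.not_hasGoodReduction (R := ℤ_[q₁]) hq₁.hasMultiplicativeReductionAtPrime
  have hshape : ∀ (q : ℕ) [Fact q.Prime], q ≠ q₁ → p ∣ (W.baseChange ℚ_[q]).localTamagawaNumber ℤ_[q] →
      W.HasSplitMultiplicativeReductionAtPrime q := by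
    intro q _ _ hdvd
    haveI : (W.baseChange ℚ_[q]).IsElliptic := inferInstanceAs (W.map (algebraMap ℚ ℚ_[q])).IsElliptic
    exact hasSplitMultiplicativeReduction_of_five_le_of_dvd_localTamagawaNumber q (W.baseChange ℚ_[q]) hp5 hdvd
  refine Theorems.missingUpperBoundAt_of_classX11b_of_inertSet_of_extraPlace_odd_of_twinLowerD₂ hGZK hmod hnf hMaz hBR hJL hCO W p
    hX q₁ hbad₁ hshape (hSavD W p q₁ hX hp5 hsurj hnram hq₁ hoff)
    (Theorems.fhTwinLowerSupplyAt_of_friedbergHoffstein_of_x11aLowerHalf hGZK hmod hnf hFH W p hX hnram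
      (fun Wd _ _ hXa ↦ hX11a Wd p hXa))
    S hSmult hSeven hpS hq₁S (fun ℓ _ hℓS hℓq hs ↦ hFC ℓ hℓS hℓq hs) ?_
  rcases hdeg with hW | hP
  · exact Or.inl ⟨p, inferInstance, hX.2.2.1, hW, Or.inl hpS⟩
  · exact Or.inr hP

/-! ### §2 With the (W)-witness at `p` a datum always exists -/

/-- **If `p ∤ ord_p Δ_min` then an inert₂ datum or an up-to-one₂♯ datum exists** (`p ≥ 5` multiplicative, some multiplicative prime `≠ p`): with no offender
`S = {p, m}` (coarse lemma p618823), with an odd number of offenders `S = {p} ∪ Off`, with an even positive number `S = {p} ∪ Off ∖ {e}` exempting any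
offender `e` — the (DEG) clause is the witness `p` in all cases, no pairing half needed. Bookkeeping only. [cite: PastenShimura2024, Lemma 6.15] -/
theorem inertDatum₂_or_upToOneSharpDatum₂_of_not_dvd_ordp
    (W : WeierstrassCurve ℚ) [W.IsElliptic] [W.IsGloballyMinimal] (p : ℕ) [Fact p.Prime] (hp5 : 5 ≤ p) (hmult : Mult W p)
    (hother : ∃ ℓ : ℕ, ∃ _ : Fact ℓ.Prime, ℓ ≠ p ∧ W.HasMultiplicativeReductionAtPrime ℓ)
    (hW : ¬ p ∣ padicValInt p W.minimalDiscriminantInt) :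
    (∃ S : Finset ℕ, (∀ ℓ ∈ S, ∃ _ : Fact ℓ.Prime, Mult W ℓ) ∧ Even S.card ∧ p ∈ S ∧
        (∀ (ℓ : ℕ) [Fact ℓ.Prime], ℓ ∉ S → W.HasSplitMultiplicativeReductionAtPrime ℓ →
          ¬ p ∣ padicValInt ℓ W.minimalDiscriminantInt) ∧
        (¬ p ∣ padicValInt p W.minimalDiscriminantInt ∨
          ∃ R ⊆ S, S.card = 2 * R.card ∧ ∀ q ∈ R, ¬ p ∣ q - 1)) ∨
      (∃ (q₁ : ℕ) (_ : Fact q₁.Prime) (S : Finset ℕ), W.HasSplitMultiplicativeReductionAtPrime q₁ ∧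
        p ∣ padicValInt q₁ W.minimalDiscriminantInt ∧
        (∀ ℓ ∈ S, ∃ _ : Fact ℓ.Prime, Mult W ℓ) ∧ Even S.card ∧ p ∈ S ∧ q₁ ∉ S ∧
        (∀ (ℓ : ℕ) [Fact ℓ.Prime], ℓ ∉ S → ℓ ≠ q₁ → W.HasSplitMultiplicativeReductionAtPrime ℓ →
          ¬ p ∣ padicValInt ℓ W.minimalDiscriminantInt) ∧
        (¬ p ∣ padicValInt p W.minimalDiscriminantInt ∨
          ∃ R ⊆ S, S.card = 2 * R.card ∧ ∀ q ∈ R, ¬ p ∣ q - 1)) := by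
  -- the offenders `≠ p`, a finite set (they divide the conductor)
  set POff : ℕ → Prop := fun q ↦ ∃ _ : Fact q.Prime, q ≠ p ∧ W.HasSplitMultiplicativeReductionAtPrime q ∧
    p ∣ padicValInt q W.minimalDiscriminantInt with hPOff
  have hN0 : W.conductorNorm ℤ ≠ 0 := Nat.pos_iff_ne_zero.mp (WeierstrassCurve.conductorNorm_pos_holds (W := W))
  set Off : Finset ℕ := (W.conductorNorm ℤ).primeFactors.filter POff with hOffdef
  have memOff : ∀ q : ℕ, q ∈ Off ↔ POff q := by
    intro q
    simp only [hOffdef, Finset.mem_filter, Nat.mem_primeFactors]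
    refine ⟨fun h ↦ h.2, fun h ↦ ⟨?_, h⟩⟩
    obtain ⟨hF, -, hs, -⟩ := h
    exact ⟨hF.out, dvd_conductorNorm_of_mult hs.hasMultiplicativeReductionAtPrime, hN0⟩
  have hpOff : p ∉ Off := fun h ↦ ((memOff p).mp h).2.1 rfl
  -- `insert p T` is even-multiplicative for `T ⊆ Off` with `#T` odd
  have build : ∀ T : Finset ℕ, T ⊆ Off → (T.card + 1) % 2 = 0 →
      (∀ ℓ ∈ insert p T, ∃ _ : Fact ℓ.Prime, Mult W ℓ) ∧ Even (insert p T).card ∧ p ∈ insert p T := by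
    intro T hT hpar
    have hpT : p ∉ T := fun h ↦ hpOff (hT h)
    refine ⟨?_, ?_, Finset.mem_insert_self _ _⟩
    · intro ℓ hℓ
      rcases Finset.mem_insert.mp hℓ with rfl | hℓT
      · exact ⟨inferInstance, hmult⟩
      · obtain ⟨hF, -, hs, -⟩ := (memOff ℓ).mp (hT hℓT)
        exact ⟨hF, hs.hasMultiplicativeReductionAtPrime⟩
    · rw [Finset.card_insert_of_notMem hpT, Nat.even_iff]
      exact hpar
  by_cases hOff0 : Off = ∅
  · -- no offender: the coarse lemma (its halves are in particular `¬ p ∣ q − 1`-halves; we only need the inert datum it returns)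
    have h3' : ¬ ∃ (q₁ q₂ q₃ : ℕ) (_ : Fact q₁.Prime) (_ : Fact q₂.Prime) (_ : Fact q₃.Prime),
        q₁ ≠ p ∧ q₂ ≠ p ∧ q₃ ≠ p ∧ q₁ ≠ q₂ ∧ q₁ ≠ q₃ ∧ q₂ ≠ q₃ ∧
        W.HasSplitMultiplicativeReductionAtPrime q₁ ∧ p ∣ padicValInt q₁ W.minimalDiscriminantInt ∧
        W.HasSplitMultiplicativeReductionAtPrime q₂ ∧ p ∣ padicValInt q₂ W.minimalDiscriminantInt ∧
        W.HasSplitMultiplicativeReductionAtPrime q₃ ∧ p ∣ padicValInt q₃ W.minimalDiscriminantInt := by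
      rintro ⟨q₁, -, -, hF₁, -, -, h₁p, -, -, -, -, -, h₁s, h₁d, -⟩
      have : q₁ ∈ Off := (memOff q₁).mpr ⟨hF₁, h₁p, h₁s, h₁d⟩
      rw [hOff0] at this
      exact absurd this (Finset.notMem_empty _)
    rcases inertDatum_or_upToOneDatum_of_not_threeOffending W p hp5 hmult hother h3' with
      ⟨S, hSm, hSe, hpS, hFC, -⟩ | ⟨q₁, hF₁, S, hs₁, hd₁, hSm, hSe, hpS, hq₁S, hFC, -⟩
    · exact Or.inl ⟨S, hSm, hSe, hpS, hFC, Or.inl hW⟩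
    · exact Or.inr ⟨q₁, hF₁, S, hs₁, hd₁, hSm, hSe, hpS, hq₁S, hFC, Or.inl hW⟩
  rcases Nat.even_or_odd Off.card with hev | hodd
  · -- `#Off` even and positive: exempt any offender `e`
    obtain ⟨e, heO⟩ := Finset.nonempty_iff_ne_empty.mpr hOff0
    obtain ⟨heF, hep, hes, hed⟩ := (memOff e).mp heO
    have hpar : ((Off.erase e).card + 1) % 2 = 0 := by
      rw [Finset.card_erase_of_mem heO]
      have := Finset.card_pos.mpr ⟨e, heO⟩
      have := Nat.even_iff.mp hev
      omega
    obtain ⟨hmemS, hevenS, hpS⟩ := build (Off.erase e) (Finset.erase_subset _ _) hpar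
    refine Or.inr ⟨e, heF, insert p (Off.erase e), hes, hed, hmemS, hevenS, hpS, ?_, ?_, Or.inl hW⟩
    · simp only [Finset.mem_insert, Finset.mem_erase, not_or, not_and]
      exact ⟨hep, fun h _ ↦ h rfl⟩
    · intro ℓ _ hℓS hℓe hℓs hℓd
      apply hℓS
      simp only [Finset.mem_insert, Finset.mem_erase]
      rcases eq_or_ne ℓ p with rfl | hℓp
      · exact Or.inl rfl
      · exact Or.inr ⟨hℓe, (memOff ℓ).mpr ⟨inferInstance, hℓp, hℓs, hℓd⟩⟩
  · -- `#Off` odd: take every offender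
    have hpar : (Off.card + 1) % 2 = 0 := by rw [Nat.odd_iff] at hodd; omega
    obtain ⟨hmemS, hevenS, hpS⟩ := build Off le_rfl hpar
    refine Or.inl ⟨insert p Off, hmemS, hevenS, hpS, ?_, Or.inl hW⟩
    intro ℓ _ hℓS hℓs hℓd
    apply hℓS
    simp only [Finset.mem_insert]
    rcases eq_or_ne ℓ p with rfl | hℓp
    · exact Or.inl rfl
    · exact Or.inr ((memOff ℓ).mpr ⟨inferInstance, hℓp, hℓs, hℓd⟩)

/-! ### §3 The level-lowering cut: on semistable curves `p` is a (W)-witness -/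

/-- **(W)-witness at `p` for free on SEMISTABLE curves.** `E` semistable, X11b at `p` (multiplicative, `E[p]` irreducible, `p ≠ 2`) and NO (ram) prime ⟹
`p ∤ ord_p Δ_min`: otherwise `E[p]` is finite at `p`, unramified at every other bad prime, and Ribet–Diamond level lowering yields a weight-2 cusp form of level
one. Contrapositive of the TREE theorem `ram_of_semistable_of_irr_of_mult_of_dvd` (printed inputs: modularity `exists_isNewformOf`, `diamond1995_refinedSerre`).
bsd-idea-9 g3's §3a. [cite: Ribet1990, Thm. 1.1] [cite: Diamond1995RefinedSerre, Thm. 1.1] [cite: Serre1987, §4.1 (4.1.12)] -/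
theorem not_dvd_ordp_of_semistable_of_not_ram (hnf : exists_isNewformOf) (hLL : diamond1995_refinedSerre)
    (W : WeierstrassCurve ℚ) [W.IsElliptic] [W.IsGloballyMinimal] (p : ℕ) [Fact p.Prime]
    (hX : ClassX11b W p) (hsst : Semistable W) (hnram : ¬ Ram W p) :
    ¬ p ∣ padicValInt p W.minimalDiscriminantInt := fun h ↦
  hnram (ram_of_semistable_of_irr_of_mult_of_dvd hnf hLL W p hX.2.1 hX.2.2.1 h hsst hX.2.2.2)

/-! ### §4 v9's S2b shape from the inert₂ road, the up-to-one₂♯ road and the v11 residual «non-semistable self-carrier, three offenders ≡ 1 (mod p)» -/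

/-- **S2b of line `birth` (`Statement.stub_res_otherMultNoSplitDatumAtFive`) VERBATIM as conclusion, BY CASES:** inert₂ datum → `hI₂` (p609923's ∀-form);
up-to-one₂♯ datum → `hU₂` (§1's ∀-form); otherwise `p ∣ ord_p Δ_min` (§2), hence `¬ Semistable W` (§3, from `exists_isNewformOf` + `diamond1995_refinedSerre`),
and three distinct offending split carriers `≡ 1 (mod p)` (datum lemma₂ p625102, the ♯ datum being weaker than the plain one) — the v11 RESIDUAL `hC3₃`.
Pure logic; CONDITIONAL on the ∀-binders and the two printed facts; nothing booked. [cite: PastenShimura2024, Lemma 6.18] [cite: Ribet1990, Thm. 1.1] -/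
theorem res_otherMultNoSplitDatumAtFive_of_inert₂_of_upToOne₂Sharp_of_nonSemistableSelfCarrier
    (hnf : exists_isNewformOf) (hLL : diamond1995_refinedSerre)
    (hI₂ : ∀ (W : WeierstrassCurve ℚ) [W.IsElliptic] [W.IsGloballyMinimal] (p : ℕ) [Fact p.Prime],
      ClassX11b W p → 5 ≤ p → Surj W p → ¬ Ram W p →
        (∃ S : Finset ℕ, (∀ ℓ ∈ S, ∃ _ : Fact ℓ.Prime, Mult W ℓ) ∧ Even S.card ∧ p ∈ S ∧
          (∀ (ℓ : ℕ) [Fact ℓ.Prime], ℓ ∉ S → W.HasSplitMultiplicativeReductionAtPrime ℓ →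
            ¬ p ∣ padicValInt ℓ W.minimalDiscriminantInt) ∧
          (¬ p ∣ padicValInt p W.minimalDiscriminantInt ∨
            ∃ R ⊆ S, S.card = 2 * R.card ∧ ∀ q ∈ R, ¬ p ∣ q - 1)) →
          Typed.MissingUpperBoundAt W p)
    (hU₂ : ∀ (W : WeierstrassCurve ℚ) [W.IsElliptic] [W.IsGloballyMinimal] (p : ℕ) [Fact p.Prime],
      ClassX11b W p → 5 ≤ p → Surj W p → ¬ Ram W p →
      (∃ (q₁ : ℕ) (_ : Fact q₁.Prime) (S : Finset ℕ), W.HasSplitMultiplicativeReductionAtPrime q₁ ∧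
        p ∣ padicValInt q₁ W.minimalDiscriminantInt ∧
        (∀ ℓ ∈ S, ∃ _ : Fact ℓ.Prime, Mult W ℓ) ∧ Even S.card ∧ p ∈ S ∧ q₁ ∉ S ∧
        (∀ (ℓ : ℕ) [Fact ℓ.Prime], ℓ ∉ S → ℓ ≠ q₁ → W.HasSplitMultiplicativeReductionAtPrime ℓ →
          ¬ p ∣ padicValInt ℓ W.minimalDiscriminantInt) ∧
        (¬ p ∣ padicValInt p W.minimalDiscriminantInt ∨
          ∃ R ⊆ S, S.card = 2 * R.card ∧ ∀ q ∈ R, ¬ p ∣ q - 1)) →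
      Typed.MissingUpperBoundAt W p)
    (hC3₃ : ∀ (W : WeierstrassCurve ℚ) [W.IsElliptic] [W.IsGloballyMinimal] (p : ℕ) [Fact p.Prime],
      ClassX11b W p → 5 ≤ p → Surj W p → ¬ Ram W p → p ∣ W.tamagawaProduct →
      (∃ ℓ : ℕ, ∃ _ : Fact ℓ.Prime, ℓ ≠ p ∧ W.HasMultiplicativeReductionAtPrime ℓ) →
      ¬ Semistable W → p ∣ padicValInt p W.minimalDiscriminantInt →
      (∃ (q₁ q₂ q₃ : ℕ) (_ : Fact q₁.Prime) (_ : Fact q₂.Prime) (_ : Fact q₃.Prime),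
        q₁ ≠ p ∧ q₂ ≠ p ∧ q₃ ≠ p ∧ q₁ ≠ q₂ ∧ q₁ ≠ q₃ ∧ q₂ ≠ q₃ ∧
        (W.HasSplitMultiplicativeReductionAtPrime q₁ ∧ p ∣ padicValInt q₁ W.minimalDiscriminantInt ∧ p ∣ q₁ - 1) ∧
        (W.HasSplitMultiplicativeReductionAtPrime q₂ ∧ p ∣ padicValInt q₂ W.minimalDiscriminantInt ∧ p ∣ q₂ - 1) ∧
        (W.HasSplitMultiplicativeReductionAtPrime q₃ ∧ p ∣ padicValInt q₃ W.minimalDiscriminantInt ∧ p ∣ q₃ - 1)) →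
      ¬ (∃ S : Finset ℕ, (∀ ℓ ∈ S, ∃ _ : Fact ℓ.Prime, Mult W ℓ) ∧ Even S.card ∧ p ∈ S ∧
          (∀ (ℓ : ℕ) [Fact ℓ.Prime], ℓ ∉ S → W.HasSplitMultiplicativeReductionAtPrime ℓ →
            ¬ p ∣ padicValInt ℓ W.minimalDiscriminantInt) ∧
          (¬ p ∣ padicValInt p W.minimalDiscriminantInt ∨
            ∃ R ⊆ S, S.card = 2 * R.card ∧ ∀ q ∈ R, ¬ p ∣ q - 1)) →
      ¬ (∃ S : Finset ℕ, (∀ ℓ ∈ S, ∃ _ : Fact ℓ.Prime, Mult W ℓ) ∧ Even S.card ∧ p ∉ S ∧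
          (∀ (ℓ : ℕ) [Fact ℓ.Prime], ℓ ∉ S → W.HasSplitMultiplicativeReductionAtPrime ℓ →
            ¬ p ∣ padicValInt ℓ W.minimalDiscriminantInt) ∧
          ((∃ (ℓ₀ : ℕ) (_ : Fact ℓ₀.Prime), Mult W ℓ₀ ∧ ℓ₀ ≠ p ∧ ¬ p ∣ padicValInt ℓ₀ W.minimalDiscriminantInt) ∨
            ∃ R ⊆ S, S.card = 2 * R.card ∧ ∀ q ∈ R, ¬ p ∣ q - 1)) →
      ¬ (∃ (q₁ : ℕ) (_ : Fact q₁.Prime) (S : Finset ℕ), W.HasSplitMultiplicativeReductionAtPrime q₁ ∧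
          p ∣ padicValInt q₁ W.minimalDiscriminantInt ∧
          (∀ ℓ ∈ S, ∃ _ : Fact ℓ.Prime, Mult W ℓ) ∧ Even S.card ∧ p ∈ S ∧ q₁ ∉ S ∧
          (∀ (ℓ : ℕ) [Fact ℓ.Prime], ℓ ∉ S → ℓ ≠ q₁ → W.HasSplitMultiplicativeReductionAtPrime ℓ →
            ¬ p ∣ padicValInt ℓ W.minimalDiscriminantInt) ∧
          (¬ p ∣ padicValInt p W.minimalDiscriminantInt ∨
            ∃ R ⊆ S, S.card = 2 * R.card ∧ ∀ q ∈ R, ¬ p ∣ q - 1)) →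
      Typed.MissingUpperBoundAt W p) :
    ∀ (W : WeierstrassCurve ℚ) [W.IsElliptic] [W.IsGloballyMinimal] (p : ℕ) [Fact p.Prime],
      ClassX11b W p → 5 ≤ p → Surj W p → ¬ Ram W p → p ∣ W.tamagawaProduct →
      (∃ ℓ : ℕ, ∃ _ : Fact ℓ.Prime, ℓ ≠ p ∧ W.HasMultiplicativeReductionAtPrime ℓ) →
      ¬ (∃ S : Finset ℕ, (∀ ℓ ∈ S, ∃ _ : Fact ℓ.Prime, Mult W ℓ) ∧ Even S.card ∧ p ∈ S ∧
          (∀ (ℓ : ℕ) [Fact ℓ.Prime], ℓ ∉ S → W.HasSplitMultiplicativeReductionAtPrime ℓ →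
            ¬ p ∣ padicValInt ℓ W.minimalDiscriminantInt) ∧
          (¬ p ∣ padicValInt p W.minimalDiscriminantInt ∨
            ∃ R ⊆ S, S.card = 2 * R.card ∧ ∀ q ∈ R, q ≠ 2 ∧ ¬ p ∣ q - 1)) →
      ¬ (∃ S : Finset ℕ, (∀ ℓ ∈ S, ∃ _ : Fact ℓ.Prime, Mult W ℓ) ∧ Even S.card ∧ p ∉ S ∧
          (∀ (ℓ : ℕ) [Fact ℓ.Prime], ℓ ∉ S → W.HasSplitMultiplicativeReductionAtPrime ℓ →
            ¬ p ∣ padicValInt ℓ W.minimalDiscriminantInt) ∧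
          ((∃ (ℓ₀ : ℕ) (_ : Fact ℓ₀.Prime), Mult W ℓ₀ ∧ ℓ₀ ≠ p ∧ ¬ p ∣ padicValInt ℓ₀ W.minimalDiscriminantInt) ∨
            ∃ R ⊆ S, S.card = 2 * R.card ∧ ∀ q ∈ R, ¬ p ∣ q - 1)) →
      Typed.MissingUpperBoundAt W p := by
  intro W _ _ p _ hX hp5 hsurj hnram htam hother _hnoI hnoD
  by_cases hI : ∃ S : Finset ℕ, (∀ ℓ ∈ S, ∃ _ : Fact ℓ.Prime, Mult W ℓ) ∧ Even S.card ∧ p ∈ S ∧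
      (∀ (ℓ : ℕ) [Fact ℓ.Prime], ℓ ∉ S → W.HasSplitMultiplicativeReductionAtPrime ℓ →
        ¬ p ∣ padicValInt ℓ W.minimalDiscriminantInt) ∧
      (¬ p ∣ padicValInt p W.minimalDiscriminantInt ∨
        ∃ R ⊆ S, S.card = 2 * R.card ∧ ∀ q ∈ R, ¬ p ∣ q - 1)
  · exact hI₂ W p hX hp5 hsurj hnram hI
  by_cases hU : ∃ (q₁ : ℕ) (_ : Fact q₁.Prime) (S : Finset ℕ), W.HasSplitMultiplicativeReductionAtPrime q₁ ∧
      p ∣ padicValInt q₁ W.minimalDiscriminantInt ∧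
      (∀ ℓ ∈ S, ∃ _ : Fact ℓ.Prime, Mult W ℓ) ∧ Even S.card ∧ p ∈ S ∧ q₁ ∉ S ∧
      (∀ (ℓ : ℕ) [Fact ℓ.Prime], ℓ ∉ S → ℓ ≠ q₁ → W.HasSplitMultiplicativeReductionAtPrime ℓ →
        ¬ p ∣ padicValInt ℓ W.minimalDiscriminantInt) ∧
      (¬ p ∣ padicValInt p W.minimalDiscriminantInt ∨
        ∃ R ⊆ S, S.card = 2 * R.card ∧ ∀ q ∈ R, ¬ p ∣ q - 1)
  · exact hU₂ W p hX hp5 hsurj hnram hU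
  -- no datum: `p` is a self-carrier (§2), hence `E` is not semistable (§3)
  have hpd : p ∣ padicValInt p W.minimalDiscriminantInt := by
    by_contra hW
    rcases inertDatum₂_or_upToOneSharpDatum₂_of_not_dvd_ordp W p hp5 hX.2.2.1 hother hW with hI' | hU'
    · exact hI hI'
    · exact hU hU'
  have hns : ¬ Semistable W := fun hsst ↦ not_dvd_ordp_of_semistable_of_not_ram hnf hLL W p hX hsst hnram hpd
  by_cases h3 : ∃ (q₁ q₂ q₃ : ℕ) (_ : Fact q₁.Prime) (_ : Fact q₂.Prime) (_ : Fact q₃.Prime),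
      q₁ ≠ p ∧ q₂ ≠ p ∧ q₃ ≠ p ∧ q₁ ≠ q₂ ∧ q₁ ≠ q₃ ∧ q₂ ≠ q₃ ∧
      (W.HasSplitMultiplicativeReductionAtPrime q₁ ∧ p ∣ padicValInt q₁ W.minimalDiscriminantInt ∧ p ∣ q₁ - 1) ∧
      (W.HasSplitMultiplicativeReductionAtPrime q₂ ∧ p ∣ padicValInt q₂ W.minimalDiscriminantInt ∧ p ∣ q₂ - 1) ∧
      (W.HasSplitMultiplicativeReductionAtPrime q₃ ∧ p ∣ padicValInt q₃ W.minimalDiscriminantInt ∧ p ∣ q₃ - 1)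
  · exact hC3₃ W p hX hp5 hsurj hnram htam hother hns hpd h3 hI hnoD hU
  · rcases inertDatum₂_or_upToOneDatum₂_of_not_threeOneModOffending W p hp5 hX.2.2.1 hother h3 with
      hI' | ⟨q₁, hF₁, S, hs₁, hd₁, hSm, hSe, hpS, hq₁S, hFC, hR⟩
    · exact absurd hI' hI
    · exact absurd ⟨q₁, hF₁, S, hs₁, hd₁, hSm, hSe, hpS, hq₁S, hFC, Or.inr hR⟩ hU

end Summit.BirchSwinnertonDyer.BirchSwinnertonDyer.Theorems.EulerHalfInertUpToOne

end
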